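import Summits.Ventures.PercRepro.S1ConeNineteen
import Summits.Ventures.PercRepro.S1CellTenSevenSmall

/-!
# PercRepro — THE CAP (P10): TEN TRIANGLES AT NULLITY SIX, `s₄ ≤ 30` (p2, gen 25; SUBCLAIM-S1 §6.9 (x))

An `e`-free matroid of nullity `6` with at most `10` points, `10` triangles and every point on at least `3` of them
has exactly `10` points (a rank-`≤ 3` ground set holds `≤ 6` points, hence no triangle, so the rank is `≥ 4`) and,
by the double count `Σ_x deg x = 30`, every point on EXACTLY `3` triangles. Through any point `x` the nineteen-
candidate bound (S1ConeNineteen) reads `#{four-circuits ∋ x} + 7 ≤ 19`, so `4·s₄ = Σ_x #{∋ x} ≤ 120` and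
**`s₄ ≤ 30`** — the cap (P10) of `c025_core_ten_seven_of_small_caps` holds with `30 ≤ 32`.

* **`cap_ten_of_nullity_six`** — (P10) in the exact spelling of the reduction's hypothesis `hP10`;
* **`c025_core_ten_seven_of_cap_nine`** — the cell `(10, 7)` modulo (P9) ALONE.
Axioms: standard.
-/

open scoped Matroid

namespace PercRepro

namespace S1

open Set

variable {α : Type}

open Classical in
/-- **(P10)**: an `e`-free matroid of nullity `6` with `≤ 10` points, `10` triangles and every point on `≥ 3`
triangles has at most `32` (indeed `30`) four-circuits. -/
theorem cap_ten_of_nullity_six (N : Matroid α) [N.Finite]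
    (hfree : ∀ e ∈ N.E, ∃ A ⊆ N.E \ {e}, e ∉ N.closure A ∧ e ∉ N.closure ((N.E \ {e}) \ A))
    (hd : N.E.encard = N.eRank + ((6 : ℕ) : ℕ∞)) (hn : N.E.ncard ≤ 10)
    (h10 : {C : Set α | N.IsCircuit C ∧ C.ncard = 3}.ncard = 10)
    (hdeg : ∀ x ∈ N.E, 3 ≤ {C : Set α | N.IsCircuit C ∧ C.ncard = 3 ∧ x ∈ C}.ncard) :
    {C : Set α | N.IsCircuit C ∧ C.ncard = 4}.ncard ≤ 32 := by
  have hEfin : N.E.Finite := N.ground_finite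
  -- the core facts
  have hL : ∀ e ∈ N.E, ¬ N.IsLoop e := ThmN.not_isLoop_of_free N hfree
  have hs : ∀ e ∈ N.E, ∀ f ∈ N.E, e ≠ f → N.eRk {e, f} = 2 := by
    intro e he f hf hef
    have h2 : (2 : ℕ∞) ≤ N.eRk {e, f} :=
      ThmN.two_le_eRk_of_two_le_ncard_of_free N hfree (pair_subset he hf) (by rw [ncard_pair hef])
    have h3 : N.eRk {e, f} ≤ 2 := by
      have := N.eRk_le_encard {e, f}
      rwa [encard_pair hef] at this
    exact le_antisymm h3 h2
  have hcirc' : ∀ C, N.IsCircuit C → 3 ≤ C.encard := ThmN.three_le_encard_of_circuit N hL hs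
  have hcirc : ∀ C, N.IsCircuit C → 3 ≤ C.ncard := by
    intro C hC
    have h := hcirc' C hC
    rw [← (hEfin.subset hC.subset_ground).cast_ncard_eq] at h
    exact_mod_cast h
  have hC1 : ∀ L ⊆ N.E, N.eRk L = 2 → L.ncard ≤ 3 := by
    intro L hL' hr
    have := ThmN.ncard_add_one_le_two_pow_of_eRk_le N hL hfree 2 L hL' hr.le
    omega
  have hC2 : ∀ P ⊆ N.E, N.eRk P ≤ 3 → P.ncard ≤ 6 := fun P hP hr =>
    ThmN.ncard_le_six_of_eRk_le_three_of_free N hfree hP hr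
  -- the finsets and the double counts
  have hmem𝒯 : ∀ C, C ∈ (finite_triangles N).toFinset ↔ N.IsCircuit C ∧ C.ncard = 3 := fun C => by
    rw [Set.Finite.mem_toFinset]; rfl
  have h𝒯card : (finite_triangles N).toFinset.card = 10 := by
    rw [← h10]; exact (Set.ncard_eq_toFinset_card _ (finite_triangles N)).symm
  have hmemF : ∀ C, C ∈ (finite_fourCircuits N).toFinset ↔ N.IsCircuit C ∧ C.ncard = 4 := fun C => by
    rw [Set.Finite.mem_toFinset]; rfl
  have hFcard : (finite_fourCircuits N).toFinset.card = {C : Set α | N.IsCircuit C ∧ C.ncard = 4}.ncard :=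
    (Set.ncard_eq_toFinset_card _ (finite_fourCircuits N)).symm
  have hmemE : ∀ x, x ∈ hEfin.toFinset ↔ x ∈ N.E := fun x => Set.Finite.mem_toFinset _
  have hsum3 : ∑ x ∈ hEfin.toFinset, ((finite_triangles N).toFinset.filter (fun C => x ∈ C)).card =
      3 * (finite_triangles N).toFinset.card :=
    sum_card_filter_mem N _ 3 (fun C hC => ⟨((hmem𝒯 C).1 hC).1.subset_ground, ((hmem𝒯 C).1 hC).2⟩)
  have hsum4 : ∑ x ∈ hEfin.toFinset, ((finite_fourCircuits N).toFinset.filter (fun C => x ∈ C)).card =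
      4 * (finite_fourCircuits N).toFinset.card :=
    sum_card_filter_mem N _ 4 (fun C hC => ⟨((hmemF C).1 hC).1.subset_ground, ((hmemF C).1 hC).2⟩)
  -- degrees as ncards
  have hdegset : ∀ x, ((finite_triangles N).toFinset.filter (fun C => x ∈ C)).card =
      {C : Set α | N.IsCircuit C ∧ C.ncard = 3 ∧ x ∈ C}.ncard := by
    intro x
    rw [← Set.ncard_coe_finset]
    congr 1
    ext C
    simp only [Finset.coe_filter, hmem𝒯, Set.mem_setOf_eq]
    tauto
  have hfourset : ∀ x, ((finite_fourCircuits N).toFinset.filter (fun C => x ∈ C)).card =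
      {C : Set α | N.IsCircuit C ∧ C.ncard = 4 ∧ x ∈ C}.ncard := by
    intro x
    rw [← Set.ncard_coe_finset]
    congr 1
    ext C
    simp only [Finset.coe_filter, hmemF, Set.mem_setOf_eq]
    tauto
  -- `|E| = 10`
  have hEcard : hEfin.toFinset.card = N.E.ncard := (Set.ncard_eq_toFinset_card _ hEfin).symm
  have hn10 : N.E.ncard = 10 := by
    -- the rank is at least `4`: a rank-`≤ 3` ground set has `≤ 6` points and no triangle
    obtain ⟨T, hT⟩ : ∃ T, T ∈ (finite_triangles N).toFinset := by
      by_contra h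
      push Not at h
      have : (finite_triangles N).toFinset = ∅ := Finset.eq_empty_of_forall_notMem h
      rw [this, Finset.card_empty] at h𝒯card
      omega
    have hT3 := (hmem𝒯 T).1 hT
    have hTr : N.eRk T = 2 := by
      have h := hT3.1.eRk_add_one_eq
      rw [← (hEfin.subset hT3.1.subset_ground).cast_ncard_eq, hT3.2] at h
      have hfin : N.eRk T ≠ ⊤ := ((N.eRk_le_encard T).trans_lt (hEfin.subset hT3.1.subset_ground).encard_lt_top).ne
      obtain ⟨r, hr⟩ := ENat.ne_top_iff_exists.1 hfin
      rw [← hr] at h ⊢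
      have : r + 1 = 3 := by exact_mod_cast h
      norm_cast; omega
    obtain ⟨r, hr⟩ := ENat.ne_top_iff_exists.1 ((N.eRk_le_encard N.E).trans_lt hEfin.encard_lt_top).ne
    have hd' : N.E.ncard = r + 6 := by
      have h := hd
      rw [N.eRank_def, ← hr, ← hEfin.cast_ncard_eq] at h
      exact_mod_cast h
    by_contra hne
    have hr3 : r ≤ 3 := by omega
    have hE6 : N.E.ncard ≤ 6 := hC2 N.E subset_rfl (by rw [← hr]; exact_mod_cast hr3)
    have hr0 : r = 0 := by omega
    have hle : N.eRk T ≤ N.eRk N.E := N.eRk_mono hT3.1.subset_ground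
    rw [hTr, ← hr, hr0] at hle
    exact absurd hle (by decide)
  rw [hn10] at hEcard
  -- every degree is exactly `3`
  have hdeg3 : ∀ x ∈ N.E, {C : Set α | N.IsCircuit C ∧ C.ncard = 3 ∧ x ∈ C}.ncard = 3 := by
    intro x hx
    by_contra hne
    have h4 : 4 ≤ ((finite_triangles N).toFinset.filter (fun C => x ∈ C)).card := by
      rw [hdegset]; have := hdeg x hx; omega
    have hge : ∀ y ∈ hEfin.toFinset, 3 ≤ ((finite_triangles N).toFinset.filter (fun C => y ∈ C)).card := by
      intro y hy; rw [hdegset]; exact hdeg y ((hmemE y).1 hy)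
    have hsplit := Finset.add_sum_erase hEfin.toFinset
      (fun y => ((finite_triangles N).toFinset.filter (fun C => y ∈ C)).card) ((hmemE x).2 hx)
    have hrest := Finset.card_nsmul_le_sum (hEfin.toFinset.erase x)
      (fun y => ((finite_triangles N).toFinset.filter (fun C => y ∈ C)).card) 3
      (fun y hy => hge y (Finset.mem_of_mem_erase hy))
    rw [Finset.card_erase_of_mem ((hmemE x).2 hx), hEcard, smul_eq_mul] at hrest
    rw [hsum3, h𝒯card] at hsplit
    omega
  -- the per-point bound `≤ 12`
  have hpoint : ∀ x ∈ N.E, {C : Set α | N.IsCircuit C ∧ C.ncard = 4 ∧ x ∈ C}.ncard ≤ 12 := by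
    intro x hx
    obtain ⟨L₁, L₂, L₃, h12, h13, h23, hLeq⟩ := Set.ncard_eq_three.1 (hdeg3 x hx)
    have hL₁ : L₁ ∈ ThmN.trianglesThrough N x := by
      have : L₁ ∈ {C : Set α | N.IsCircuit C ∧ C.ncard = 3 ∧ x ∈ C} := by rw [hLeq]; simp
      exact this
    have hL₂ : L₂ ∈ ThmN.trianglesThrough N x := by
      have : L₂ ∈ {C : Set α | N.IsCircuit C ∧ C.ncard = 3 ∧ x ∈ C} := by rw [hLeq]; simp
      exact this
    have hL₃ : L₃ ∈ ThmN.trianglesThrough N x := by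
      have : L₃ ∈ {C : Set α | N.IsCircuit C ∧ C.ncard = 3 ∧ x ∈ C} := by rw [hLeq]; simp
      exact this
    have hall : ∀ C ∈ ThmN.trianglesThrough N x, C = L₁ ∨ C = L₂ ∨ C = L₃ := by
      intro C hC
      have : C ∈ {C : Set α | N.IsCircuit C ∧ C.ncard = 3 ∧ x ∈ C} := hC
      rw [hLeq] at this
      simpa using this
    have h19 := ncard_fourCircuits_through_add_triangles_avoiding_le N hC1 hC2 hcirc hn10 hL₁ hL₂ hL₃ h12 h13 h23 hall
    -- the triangles avoiding `x` number `7`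
    have hsplit : {C : Set α | N.IsCircuit C ∧ C.ncard = 3}.ncard =
        {C : Set α | N.IsCircuit C ∧ C.ncard = 3 ∧ x ∈ C}.ncard +
          {C : Set α | N.IsCircuit C ∧ C.ncard = 3 ∧ x ∉ C}.ncard := by
      have hAfin : {C : Set α | N.IsCircuit C ∧ C.ncard = 3 ∧ x ∈ C}.Finite :=
        (finite_triangles N).subset (fun C hC => ⟨hC.1, hC.2.1⟩)
      have hBfin : {C : Set α | N.IsCircuit C ∧ C.ncard = 3 ∧ x ∉ C}.Finite :=
        (finite_triangles N).subset (fun C hC => ⟨hC.1, hC.2.1⟩)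
      have hdisj : Disjoint {C : Set α | N.IsCircuit C ∧ C.ncard = 3 ∧ x ∈ C}
          {C : Set α | N.IsCircuit C ∧ C.ncard = 3 ∧ x ∉ C} := by
        rw [Set.disjoint_left]
        rintro C ⟨-, -, h⟩ ⟨-, -, h'⟩
        exact h' h
      rw [← Set.ncard_union_eq hdisj hAfin hBfin]
      congr 1
      ext C
      simp only [Set.mem_setOf_eq, Set.mem_union]
      tauto
    rw [h10, hdeg3 x hx] at hsplit
    omega
  -- the double count
  have hle : ∑ x ∈ hEfin.toFinset, ((finite_fourCircuits N).toFinset.filter (fun C => x ∈ C)).card ≤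
      ∑ _x ∈ hEfin.toFinset, 12 :=
    Finset.sum_le_sum (fun x hx => by rw [hfourset]; exact hpoint x ((hmemE x).1 hx))
  rw [hsum4, Finset.sum_const, hEcard, smul_eq_mul] at hle
  rw [← hFcard]
  omega


/-- **THE CELL `(10, 7)` MODULO (P9) ALONE**: `RLS` at `(10, 4)` on every `e`-free core of rank `10` with `17`
points, provided every `e`-free matroid of nullity `6` with `≤ 13` points, `9` triangles and every point on `≥ 2`
triangles has `≤ 31` four-circuits. -/
theorem c025_core_ten_seven_of_cap_nine (M : Matroid α) [M.Finite] (hR : M.eRank = (10 : ℕ))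
    (hn : M.E.ncard = 17)
    (hfree : ∀ e ∈ M.E, ∃ A ⊆ M.E \ {e}, e ∉ M.closure A ∧ e ∉ M.closure ((M.E \ {e}) \ A))
    (hP9 : ∀ (N : Matroid α) [N.Finite],
      (∀ e ∈ N.E, ∃ A ⊆ N.E \ {e}, e ∉ N.closure A ∧ e ∉ N.closure ((N.E \ {e}) \ A)) →
      N.E.encard = N.eRank + ((6 : ℕ) : ℕ∞) → N.E.ncard ≤ 13 →
      {C : Set α | N.IsCircuit C ∧ C.ncard = 3}.ncard = 9 →
      (∀ x ∈ N.E, 2 ≤ {C : Set α | N.IsCircuit C ∧ C.ncard = 3 ∧ x ∈ C}.ncard) →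
      {C : Set α | N.IsCircuit C ∧ C.ncard = 4}.ncard ≤ 31) :
    ThmN.RLS M 10 4 :=
  c025_core_ten_seven_of_small_caps M hR hn hfree (fun N _ hfree' hd hn' h10 hdeg =>
    cap_ten_of_nullity_six N hfree' hd hn' h10 hdeg) hP9

end S1

end PercRepro
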